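import Summits.Ventures.PercRepro.S1CellTableJ

/-!
# PercRepro — S1 TAIL TABLE, JOINT FORM: the cells `21 ≤ p ≤ 24`, `16 ≤ d ≤ 400` by kernel evaluation (p2, gen 15)

`cellOK3 p d = true` on the `1540` cells `21 ≤ p ≤ 24`, `16 ≤ d ≤ 400` (numbers up to `C(424, 23)`; exact-integer twin
`mining/p2/g15/cellok4.py`: 0 false cells at `21 ≤ p ≤ 26`, `5 ≤ d ≤ 400`). With `S1CellTableJ.table_21_24`
(`5 ≤ d ≤ 15`) and `S1TailJ.cellOK3_of_tail` (`d ≥ 401`) this covers every corank `d ≥ 5` at `21 ≤ p ≤ 24`.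

* **`table_21_24_16_400`** — the `1540` tail cells.
Axioms: standard.
-/

namespace PercRepro

namespace S1

/-- **THE TAIL TABLE, JOINT FORM**: the cells `(p, d)`, `21 ≤ p ≤ 24`, `16 ≤ d ≤ 400`, by kernel evaluation. -/
theorem table_21_24_16_400 : ∀ p < 25, 21 ≤ p → ∀ d < 401, 16 ≤ d → cellOK3 p d = true := by
  decide +kernel

end S1

end PercRepro
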